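/-
Copyright: the b2b-balaban T⁴-continuum CRUX team, row NE7b leaf lineage `t4-ne7b-formalise-leaf-03` (gen 145). Project licence.
-/
import Mathlib.Analysis.Calculus.FDeriv.Basic
import Mathlib.Topology.MetricSpace.Pseudo.Defs
import Mathlib.Order.ConditionallyCompleteLattice.Basic

/-!
# THE GROWTH (UPPER) LETTER OF THE CONSTRAINED VALUE FUNCTION: `φ w′ ≤ φ w + V′(δ₀)(M(w′ − w)) + P(M(w′ − w))` — the UPPER first-order
# letter of `V` at a constrained minimiser `δ₀` over `w` passes to `φ w = inf {V δ : D δ = w}` through ANY right inverse `M` of `D`, by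
# the competitor `δ₀ + M(w′ − w)`; windowed version; and the two letters together SANDWICH `φ` — the `a = ∞` twin of the OWNER's (32)
# `…FluctuationStepGrowth`, the first-order companion of `…ConstrainedSchurTower` §3 (upper SECANT letter) next to `…ConstrainedValueDeriv` ∕
# `…ConstrainedValueWindow` (lower letter + derivative) (row NE7b, node U5c; residual (R2′) family (2), letter (ℓ2) «growth»; Mathlib only)

Cell `pub-balaban`, sub-cell `t4`, spine estimate NE7b (`T4WeightBudget.RelWeightBound`; the cell's OWN estimate — NOT PRINTED in
[Bałaban 1983–89], NOT PROVED).  Crux-route work under `Spine/NE7b/` by a row leaf on the convexity road; NOTHING of Bałaban's is named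
or asserted; no `T4Continuum/Support` leaf typed (FREEZE (0)); no `def`; zero `sorry`.  Imports: Mathlib only.

WHY.  The sockets of the road carry TWO letters per action: the lower first-order letter with a modulus ((ℓ1) — for the hard-constraint value
function: `…ConstrainedValueDeriv` §3–§4 globally, `…ConstrainedValueWindow` on a window) and the GROWTH letter
`V⁺ψ ≤ V⁺ψ₀ + D(ψ − ψ₀) + b‖ψ − ψ₀‖²` ((ℓ2) — the OWNER's (32) `…FluctuationStepGrowth` for the fluctuation INTEGRAL).  For the MINIMISATION
(`a = ∞`) step the growth letter is one line: the competitor `δ₀ + M(w′ − w)` lies on the fibre of `w′`, so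
`φ w′ ≤ V(δ₀ + M(w′ − w)) ≤ V δ₀ + V′(M(w′ − w)) + P(M(w′ − w))` whenever `V` has the UPPER letter at `δ₀` with growth form `P`; and
`V′ ∘ M` IS `Dφ(w)` by the envelope theorem (`…ConstrainedValueDeriv.fderiv_constrValue`, by name when built — here the linear term is
written `V′ (M (w′ − w))` so that nothing is imported).  `…ConstrainedSchurTower` §3 is the same mechanism in SECANT currency.

WHAT IS PROVED ([folklore]):
* §1 `constrValue_le_competitor` (`φ w′ ≤ V (δ₀ + M (w′ − w))`), **`growth_constrValue`** (`V` bounded below, `δ₀` a constrained minimiser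
  over `w`, the upper letter `V δ ≤ V δ₀ + V′ (δ − δ₀) + P (δ − δ₀)` ⊢ `φ w′ ≤ φ w + V′ (M (w′ − w)) + P (M (w′ − w))` for ALL `w′`),
  `growth_constrValue_sq` (`P ≤ b‖·‖²`, `‖M v‖ ≤ μ‖v‖` ⊢ growth constant `b μ²`).
* §2 **`twoSided_constrValue`** — with the LOWER letter as well (`ℓ ⊥ ker D`-free form: the lower letter at `δ₀` with modulus `Q ≥ 0`):
  `φ w + V′(M(w′ − w)) + Q_D(w′ − w) ≤ φ w′ ≤ φ w + V′(M(w′ − w)) + P(M(w′ − w))` — the sockets' PAIR for the constrained value function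
  (the lower half is `…ConstrainedValueDeriv.firstOrder_constrValue`'s argument, re-run in four lines to stay import-free).
* §3 ON A WINDOW: `growthOn_constrValue` (`δ₀ + M (w′ − w) ∈ K` displayed — for `w′` near `w` it follows from `K ∈ 𝓝 δ₀`,
  `growthOn_constrValue_eventually`).
* §4 a non-vacuity `example` (`D = M = id`).

NOT HERE (honest): the identification `V′ ∘ M = Dφ(w)` (it is `…ConstrainedValueDeriv` §4 ∕ `…ConstrainedValueWindow` §3 — by name when
their oleans build); Lipschitz dependence of the minimiser on `w` and `C^{1,1}` of `φ` (needs a Lipschitz derivative field — a later file);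
which `V`, `D`, `P` of Bałaban's ((A3) ∕ (A1c), NC-NE7b-α UNRULED); any value.  BY-NAME EFFECT ON THE WALL: NONE.  NE7b NOT PRINTED ∕ NOT
PROVED; spine PROVED 0∕9; rung (B)+1 on a FINITE torus — NOT infinite volume, NOT the mass gap, NOT Clay.  HONEST DEPENDENCY: continuum YM on
T⁴ ⇐ BetaPertH ∧ nine spine estimates (0/9 proved); BetaPertH ⇐ (D1) ∧ (D4) ∧ CAP+tail.
-/

set_option autoImplicit false

open Set Function Filter
open scoped Topology
namespace Summit.QuantumFields.BalabanUV.T4Continuum.NE7b.ConstrainedValueGrowth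

variable {E F : Type*} [NormedAddCommGroup E] [NormedSpace ℝ E] [NormedAddCommGroup F] [NormedSpace ℝ F]

/-! ## §1 The growth letter descends through the competitor `δ₀ + M (w′ − w)` -/

/-- **THE COMPETITOR BOUND**: `V` bounded below, `D δ₀ = w`, `M` a right inverse of `D` ⟹ `φ w′ ≤ V (δ₀ + M (w′ − w))`
(`δ₀ + M (w′ − w)` lies on the fibre of `w′`). [folklore] -/
theorem constrValue_le_competitor {V : E → ℝ} {D : E →L[ℝ] F} {M : F →L[ℝ] E} (hM : ∀ w, D (M w) = w)
    (hbdd : ∃ m, ∀ δ, m ≤ V δ) {w : F} {δ₀ : E} (hδ₀ : D δ₀ = w) (w' : F) :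
    (⨅ δ : {δ // D δ = w'}, V δ.1) ≤ V (δ₀ + M (w' - w)) := by
  obtain ⟨m, hm⟩ := hbdd
  have hb : BddBelow (range fun δ : {δ // D δ = w'} => V δ.1) := ⟨m, forall_mem_range.2 fun δ => hm δ.1⟩
  exact ciInf_le hb ⟨δ₀ + M (w' - w), by rw [map_add, hδ₀, hM, add_sub_cancel]⟩

/-- **THE GROWTH LETTER OF `V` DESCENDS TO `φ w = ⨅_{D δ = w} V δ`.**  `V` bounded below, `δ₀` a minimiser of `V` on the fibre of `w`, the
UPPER letter of `V` at `δ₀` with linear term `V′` and growth form `P` (`V δ ≤ V δ₀ + V′ (δ − δ₀) + P (δ − δ₀)` for all `δ`), `M` a right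
inverse of `D` ⟹ for EVERY `w′`: `φ w′ ≤ φ w + V′ (M (w′ − w)) + P (M (w′ − w))` — the road's (ℓ2) letter for the constrained value
function; `V′ ∘ M = Dφ(w)` by `…ConstrainedValueDeriv` §4. [folklore] -/
theorem growth_constrValue {V P : E → ℝ} {V' : E →L[ℝ] ℝ} {D : E →L[ℝ] F} {M : F →L[ℝ] E} (hM : ∀ w, D (M w) = w)
    (hbdd : ∃ m, ∀ δ, m ≤ V δ) {w : F} {δ₀ : E} (hδ₀ : D δ₀ = w) (hmin : ∀ δ, D δ = w → V δ₀ ≤ V δ)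
    (hup : ∀ δ, V δ ≤ V δ₀ + V' (δ - δ₀) + P (δ - δ₀)) (w' : F) :
    (⨅ δ : {δ // D δ = w'}, V δ.1) ≤ (⨅ δ : {δ // D δ = w}, V δ.1) + V' (M (w' - w)) + P (M (w' - w)) := by
  have hφw : V δ₀ ≤ ⨅ δ : {δ // D δ = w}, V δ.1 := by
    haveI : Nonempty {δ // D δ = w} := ⟨⟨δ₀, hδ₀⟩⟩
    exact le_ciInf fun δ => hmin δ.1 δ.2
  have h1 := constrValue_le_competitor hM hbdd hδ₀ w' (V := V)
  have h2 := hup (δ₀ + M (w' - w))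
  rw [add_sub_cancel_left] at h2
  linarith

/-- **… WITH A QUADRATIC GROWTH CONSTANT**: `P ≤ b‖·‖²` (`0 ≤ b`) and `‖M v‖ ≤ μ‖v‖` ⟹ `φ w′ ≤ φ w + V′ (M (w′ − w)) + b μ² ‖w′ − w‖²`
— the socket's growth constant for the hard step is `b‖M‖²` (the `a = ∞` value of (32)'s weight constant). [folklore] -/
theorem growth_constrValue_sq {V P : E → ℝ} {V' : E →L[ℝ] ℝ} {D : E →L[ℝ] F} {M : F →L[ℝ] E} (hM : ∀ w, D (M w) = w)
    (hbdd : ∃ m, ∀ δ, m ≤ V δ) {w : F} {δ₀ : E} (hδ₀ : D δ₀ = w) (hmin : ∀ δ, D δ = w → V δ₀ ≤ V δ)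
    (hup : ∀ δ, V δ ≤ V δ₀ + V' (δ - δ₀) + P (δ - δ₀)) {b μ : ℝ} (hb : 0 ≤ b) (hP : ∀ δ, P δ ≤ b * ‖δ‖ ^ 2)
    (hμ : ∀ v, ‖M v‖ ≤ μ * ‖v‖) (w' : F) :
    (⨅ δ : {δ // D δ = w'}, V δ.1) ≤ (⨅ δ : {δ // D δ = w}, V δ.1) + V' (M (w' - w)) + b * μ ^ 2 * ‖w' - w‖ ^ 2 := by
  have h1 := growth_constrValue hM hbdd hδ₀ hmin hup w' (P := P)
  have h2 : P (M (w' - w)) ≤ b * ‖M (w' - w)‖ ^ 2 := hP _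
  have h3 : ‖M (w' - w)‖ ^ 2 ≤ μ ^ 2 * ‖w' - w‖ ^ 2 := by
    rw [← mul_pow]
    exact pow_le_pow_left₀ (norm_nonneg _) (hμ _) 2
  nlinarith

/-! ## §2 The two letters together: the sockets' pair for the constrained value function -/

/-- **THE TWO-SIDED LETTERS FOR `φ`.**  `V` bounded below, `Q ≥ 0`, `δ₀` a constrained minimiser over `w`, `V′` annihilating `ker D`
(Fermat on the fibre — `…ConstrainedValueDeriv` §1), the LOWER letter `V δ₀ + V′ (δ − δ₀) + Q (δ − δ₀) ≤ V δ` and the UPPER letter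
`V δ ≤ V δ₀ + V′ (δ − δ₀) + P (δ − δ₀)` at `δ₀` ⟹ for every `w′`:
`φ w + V′ (M (w′ − w)) + Q_D (w′ − w) ≤ φ w′ ≤ φ w + V′ (M (w′ − w)) + P (M (w′ − w))`, `Q_D v = ⨅_{D δ = v} Q δ`. [folklore] -/
theorem twoSided_constrValue {V Q P : E → ℝ} {V' : E →L[ℝ] ℝ} {D : E →L[ℝ] F} {M : F →L[ℝ] E} (hM : ∀ w, D (M w) = w)
    (hbdd : ∃ m, ∀ δ, m ≤ V δ) (hQ0 : ∀ δ, 0 ≤ Q δ) {w : F} {δ₀ : E} (hδ₀ : D δ₀ = w) (hmin : ∀ δ, D δ = w → V δ₀ ≤ V δ)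
    (hker : ∀ κ, D κ = 0 → V' κ = 0) (hlow : ∀ δ, V δ₀ + V' (δ - δ₀) + Q (δ - δ₀) ≤ V δ)
    (hup : ∀ δ, V δ ≤ V δ₀ + V' (δ - δ₀) + P (δ - δ₀)) (w' : F) :
    (⨅ δ : {δ // D δ = w}, V δ.1) + V' (M (w' - w)) + (⨅ δ : {δ // D δ = w' - w}, Q δ.1) ≤ (⨅ δ : {δ // D δ = w'}, V δ.1) ∧
      (⨅ δ : {δ // D δ = w'}, V δ.1) ≤ (⨅ δ : {δ // D δ = w}, V δ.1) + V' (M (w' - w)) + P (M (w' - w)) := by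
  refine ⟨?_, growth_constrValue hM hbdd hδ₀ hmin hup w'⟩
  obtain ⟨m, hm⟩ := hbdd
  haveI : Nonempty {δ // D δ = w'} := ⟨⟨M w', hM w'⟩⟩
  have hbV : BddBelow (range fun δ : {δ // D δ = w} => V δ.1) := ⟨m, forall_mem_range.2 fun δ => hm δ.1⟩
  have hφw : (⨅ δ : {δ // D δ = w}, V δ.1) ≤ V δ₀ := ciInf_le hbV ⟨δ₀, hδ₀⟩
  have key : ∀ δ : {δ // D δ = w'}, V δ₀ + V' (M (w' - w)) + (⨅ δ' : {δ' // D δ' = w' - w}, Q δ'.1) ≤ V δ.1 := by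
    rintro ⟨δ, hδ⟩
    have h0 := hker (δ - δ₀ - M (w' - w)) (by rw [map_sub, map_sub, hδ, hδ₀, hM, sub_self])
    rw [map_sub, sub_eq_zero] at h0
    have hbQ : BddBelow (range fun δ' : {δ' // D δ' = w' - w} => Q δ'.1) := ⟨0, forall_mem_range.2 fun δ' => hQ0 δ'.1⟩
    have h2 : (⨅ δ' : {δ' // D δ' = w' - w}, Q δ'.1) ≤ Q (δ - δ₀) := ciInf_le hbQ ⟨δ - δ₀, by rw [map_sub, hδ, hδ₀]⟩
    have h3 := hlow δ
    rw [h0] at h3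
    linarith
  linarith [le_ciInf key]

/-! ## §3 On a window: the competitor must lie in `K` (it does for `w′` near `w` when `K ∈ 𝓝 δ₀`) -/

/-- **THE GROWTH LETTER ON A WINDOW** for ONE `w′` whose competitor `δ₀ + M (w′ − w)` lies in `K`: `V` bounded below on `K`, `δ₀ ∈ K` a
minimiser of `V` on `K ∩ {D δ = w}`, the upper letter at `δ₀` for the points of `K` ⟹
`φ_K w′ ≤ φ_K w + V′ (M (w′ − w)) + P (M (w′ − w))`, `φ_K v = ⨅ {V δ : δ ∈ K, D δ = v}`. [folklore] -/
theorem growthOn_constrValue {V P : E → ℝ} {V' : E →L[ℝ] ℝ} {D : E →L[ℝ] F} {M : F →L[ℝ] E} (hM : ∀ w, D (M w) = w)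
    {K : Set E} (hbdd : ∃ m, ∀ δ ∈ K, m ≤ V δ) {w : F} {δ₀ : E} (hδ₀K : δ₀ ∈ K) (hδ₀ : D δ₀ = w)
    (hmin : ∀ δ ∈ K, D δ = w → V δ₀ ≤ V δ) (hup : ∀ δ ∈ K, V δ ≤ V δ₀ + V' (δ - δ₀) + P (δ - δ₀)) {w' : F}
    (hcomp : δ₀ + M (w' - w) ∈ K) :
    (⨅ δ : {δ // δ ∈ K ∧ D δ = w'}, V δ.1) ≤ (⨅ δ : {δ // δ ∈ K ∧ D δ = w}, V δ.1) + V' (M (w' - w)) + P (M (w' - w)) := by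
  obtain ⟨m, hm⟩ := hbdd
  haveI : Nonempty {δ // δ ∈ K ∧ D δ = w} := ⟨⟨δ₀, hδ₀K, hδ₀⟩⟩
  have hφw : V δ₀ ≤ ⨅ δ : {δ // δ ∈ K ∧ D δ = w}, V δ.1 := le_ciInf fun δ => hmin δ.1 δ.2.1 δ.2.2
  have hb : BddBelow (range fun δ : {δ // δ ∈ K ∧ D δ = w'} => V δ.1) := ⟨m, forall_mem_range.2 fun δ => hm δ.1 δ.2.1⟩
  have h1 : (⨅ δ : {δ // δ ∈ K ∧ D δ = w'}, V δ.1) ≤ V (δ₀ + M (w' - w)) :=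
    ciInf_le hb ⟨δ₀ + M (w' - w), hcomp, by rw [map_add, hδ₀, hM, add_sub_cancel]⟩
  have h2 := hup (δ₀ + M (w' - w)) hcomp
  rw [add_sub_cancel_left] at h2
  linarith

/-- **… AND FOR ALL `w′` NEAR `w`** when `K ∈ 𝓝 δ₀`: the competitor enters the window eventually (`M` continuous). [folklore] -/
theorem growthOn_constrValue_eventually {V P : E → ℝ} {V' : E →L[ℝ] ℝ} {D : E →L[ℝ] F} {M : F →L[ℝ] E} (hM : ∀ w, D (M w) = w)
    {K : Set E} (hbdd : ∃ m, ∀ δ ∈ K, m ≤ V δ) {w : F} {δ₀ : E} (hK : K ∈ 𝓝 δ₀) (hδ₀ : D δ₀ = w)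
    (hmin : ∀ δ ∈ K, D δ = w → V δ₀ ≤ V δ) (hup : ∀ δ ∈ K, V δ ≤ V δ₀ + V' (δ - δ₀) + P (δ - δ₀)) :
    ∀ᶠ w' in 𝓝 w, (⨅ δ : {δ // δ ∈ K ∧ D δ = w'}, V δ.1) ≤
      (⨅ δ : {δ // δ ∈ K ∧ D δ = w}, V δ.1) + V' (M (w' - w)) + P (M (w' - w)) := by
  have ht : Tendsto (fun w' : F => δ₀ + M (w' - w)) (𝓝 w) (𝓝 δ₀) := by
    have hc : Continuous fun w' : F => δ₀ + M (w' - w) := by fun_prop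
    simpa using hc.tendsto w
  exact (ht.eventually_mem hK).mono fun w' hw' => growthOn_constrValue hM hbdd (mem_of_mem_nhds hK) hδ₀ hmin hup hw'

/-! ## §4 Toy check (kernel): the letters are jointly inhabited — `D = M = id`, `φ = V` -/

example {V P : E → ℝ} {V' : E →L[ℝ] ℝ} (hbdd : ∃ m, ∀ δ, m ≤ V δ) {w : E}
    (hup : ∀ δ, V δ ≤ V w + V' (δ - w) + P (δ - w)) (w' : E) :
    (⨅ δ : {δ // (ContinuousLinearMap.id ℝ E) δ = w'}, V δ.1) ≤
      (⨅ δ : {δ // (ContinuousLinearMap.id ℝ E) δ = w}, V δ.1) + V' ((ContinuousLinearMap.id ℝ E) (w' - w))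
        + P ((ContinuousLinearMap.id ℝ E) (w' - w)) :=
  growth_constrValue (D := ContinuousLinearMap.id ℝ E) (M := ContinuousLinearMap.id ℝ E) (fun _ => rfl) hbdd rfl
    (fun δ hδ => by
      have hδ' : δ = w := hδ
      rw [hδ']) hup w'

end Summit.QuantumFields.BalabanUV.T4Continuum.NE7b.ConstrainedValueGrowth
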